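import Summits.Ventures.CertifiedManyBodySolver.Theorems.M3x2EdgeSplitSymReplayNormalOrder
import HarnessLib

/-!
# SymReplay S2 — licensed affine-`D₄` moves are window identifications; collector soundness; move equivariance; `canonA` value soundness (T4; proofs by hub-lb-sym-plan-1 / hub-lb-sym-ref-1, rev 2–7)
No summit or crux statement is proved here; no certificate beyond toys is replayed; nothing here predicts superconductivity.
-/

noncomputable section

namespace Summit.Ventures.CertifiedManyBodySolver.Theorems.SymReplay

open Matrix Finset
open Literature.MathematicalPhysics.QuantumLattice
open Literature.MathematicalPhysics.QuantumLattice.HubbardWave0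
open Literature.MathematicalPhysics.QuantumLattice.ThermodynamicLimit
open Literature.Probability.LatticeModels
open Literature.MathematicalPhysics.QuantumManyBody.StateRelaxation
open Summit.Ventures.CertifiedManyBodySolver.Theorems.WardSlot
open scoped ComplexOrder BigOperators

/-- A licensed move keeps letters inside the frame. -/
theorem moveSite_mem {Λ Λ' : Finset (Site 2)} {γ : DihedralGroup 4} {v : Site 2}
    (hsh : d4ShiftSet γ v Λ ⊆ Λ') {x : Site 2} (hx : x ∈ Λ) : moveSite γ v x ∈ Λ' := by
  have h := d4Vec_add_mem_d4ShiftSet γ v hx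
  rw [← d4R_eq_d4Vec] at h
  exact hsh h

/-- The moved site as an ordered site of `Λ'` is the image of `pt x` under `incl hsh ∘ d4Emb γ v Λ`. -/
theorem pt_moveSite {Λ Λ' : Finset (Site 2)} {γ : DihedralGroup 4} {v : Site 2}
    (hsh : d4ShiftSet γ v Λ ⊆ Λ') {x : Site 2} (hx : x ∈ Λ) :
    PolySite.pt (moveSite γ v x) (moveSite_mem hsh hx) =
      (PolySite.incl hsh) (PolySite.d4Emb γ v Λ (PolySite.pt x hx)) := by
  apply Subtype.ext
  show toLex (moveSite γ v x) = toLex (d4Vec γ (ofLex (toLex x)) + v)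
  rw [moveSite, d4R_eq_d4Vec]
  rfl

/-- **S2 is PROVED** (no `sorry`): licensed affine-`D₄` moves of words are window identification terms. -/
theorem stub_moveSound : MoveSound := by
  intro Λ Λ' hΛ γ v hsh u hu
  induction u with
  | nil =>
    exact ⟨1, by simp, by simp [moveWord]⟩
  | cons ℓ u ih =>
    obtain ⟨Y, hY, hY'⟩ := ih (fun m hm => hu m (List.mem_cons_of_mem _ hm))
    have hℓ : ℓ.x ∈ Λ := hu ℓ (List.mem_cons_self)
    refine ⟨ladderLetter (orb (PolySite.pt ℓ.x hℓ) ℓ.s, ℓ.dag) * Y, ?_, ?_⟩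
    · rw [wordOp_cons, map_mul, fermionEmbed_ladderLetter, hY]
      congr 1
      simp only [letterOp, dif_pos (hΛ hℓ)]
      rfl
    · have hm : moveSite γ v ℓ.x ∈ Λ' := moveSite_mem hsh hℓ
      show wordOp Λ' (⟨moveSite γ v ℓ.x, ℓ.s, ℓ.dag⟩ :: moveWord γ v u) = _
      rw [wordOp_cons, map_mul, map_mul, fermionEmbed_ladderLetter, fermionEmbed_ladderLetter, hY']
      congr 1
      simp only [letterOp, dif_pos hm]
      rw [pt_moveSite hsh hℓ]
      rfl

/-! #### Collector SOUNDNESS (sym-ref-1 `Collect2Sound.lean` b84e4d3d70e5e0b2 §Sound, VERBATIM modulo the names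
`collect2 ↦ collect`, `isZero2 ↦ isZero`; `evalP (wordOp Λ') = polyOp Λ'` definitionally).  These are exactly the
two collector facts S4 `stub_soundOfKernels` consumes: `collect_eval`, `isZero_sound`. -/

section CollectSound

variable {M : Type*} [AddCommGroup M] [Module ℂ M]

/-- Helper `polyOp_eq_evalP` (S2/collector chain). -/
theorem polyOp_eq_evalP (Λ' : Finset (Site 2)) (p : QPoly) : polyOp Λ' p = evalP (wordOp Λ') p := rfl

omit [Module ℂ M] in
/-- Helper `Letter.beq_iff` (S2/collector chain). -/
theorem Letter.beq_iff (a b : Letter) : a.beq b = true ↔ a = b := by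
  cases a; cases b
  simp [Letter.beq, Letter.modeEq, siteEq_iff, Bool.and_eq_true]
  tauto

omit [Module ℂ M] in
/-- Helper `wordEq_iff` (S2/collector chain). -/
theorem wordEq_iff : ∀ (u v : Word), wordEq u v = true ↔ u = v
  | [], [] => by simp [wordEq]
  | [], _ :: _ => by simp [wordEq]
  | _ :: _, [] => by simp [wordEq]
  | a :: u, b :: v => by simp [wordEq, Bool.and_eq_true, Letter.beq_iff, wordEq_iff u v]

/-- Helper `evalP_nil` (S2/collector chain). -/
@[simp] theorem evalP_nil (f : Word → M) : evalP f [] = 0 := by simp [evalP]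

/-- Helper `evalP_cons` (S2/collector chain). -/
@[simp] theorem evalP_cons (f : Word → M) (t : ℚ × Word) (p : QPoly) :
    evalP f (t :: p) = ((t.1 : ℚ) : ℂ) • f t.2 + evalP f p := by simp [evalP]

/-- Helper `evalP_append` (S2/collector chain). -/
theorem evalP_append (f : Word → M) (p q : QPoly) : evalP f (p ++ q) = evalP f p + evalP f q := by
  simp [evalP, List.map_append, List.sum_append]

/-- Helper `evalP_perm` (S2/collector chain). -/
theorem evalP_perm (f : Word → M) {p q : QPoly} (h : p.Perm q) : evalP f p = evalP f q := by
  unfold evalP; exact (h.map _).sum_eq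

omit [Module ℂ M] in
/-- `mergeF` only interleaves: a permutation of `p ++ q` at every fuel (no fuel-adequacy debt). -/
theorem mergeF_perm : ∀ (n : ℕ) (p q : QPoly), (mergeF n p q).Perm (p ++ q)
  | 0, p, q => by simp [mergeF]
  | _ + 1, [], q => by simp [mergeF]
  | _ + 1, t :: p, [] => by simp [mergeF]
  | n + 1, t :: p, t' :: q => by
    simp only [mergeF]
    split
    · exact ((mergeF_perm n (t :: p) q).cons t').trans List.perm_middle.symm
    · exact ((mergeF_perm n p (t' :: q)).cons t).trans (by simp)

omit [Module ℂ M] in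
/-- Helper `mergePairs_flatten` (S2/collector chain). -/
theorem mergePairs_flatten : ∀ (n : ℕ) (l : List QPoly), (mergePairs n l).flatten.Perm l.flatten
  | n, [] => by simp [mergePairs]
  | n, [p] => by simp [mergePairs]
  | n, p :: q :: rest => by
    simp only [mergePairs, List.flatten_cons, ← List.append_assoc]
    exact (mergeF_perm n p q).append (mergePairs_flatten n rest)

omit [Module ℂ M] in
/-- Helper `foldr_append_nil_eq_flatten` (S2/collector chain). -/
theorem foldr_append_nil_eq_flatten : ∀ (l : List QPoly), l.foldr (· ++ ·) [] = l.flatten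
  | [] => rfl
  | p :: l => by simp [List.foldr, foldr_append_nil_eq_flatten l]

omit [Module ℂ M] in
/-- Helper `mergeAll_perm` (S2/collector chain). -/
theorem mergeAll_perm : ∀ (k n : ℕ) (l : List QPoly), (mergeAll k n l).Perm l.flatten := by
  intro k
  induction k with
  | zero =>
    intro n l
    match l with
    | [] => simp [mergeAll]
    | [p] => simp [mergeAll]
    | p :: q :: rest =>
      rw [mergeAll.eq_def]
      simp [foldr_append_nil_eq_flatten]
  | succ k ih =>
    intro n l
    match l with
    | [] => simp [mergeAll]
    | [p] => simp [mergeAll]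
    | p :: q :: rest =>
      rw [mergeAll.eq_def]
      simp only
      exact (ih n _).trans (mergePairs_flatten n _)

omit [Module ℂ M] in
/-- Helper `sortW_perm` (S2/collector chain). -/
theorem sortW_perm (p : QPoly) : (sortW p).Perm p := by
  unfold sortW
  refine (mergeAll_perm _ _ _).trans ?_
  have : (p.map fun t => [t]).flatten = p := by
    induction p with
    | nil => rfl
    | cons t p ih => simp [ih]
  rw [this]

/-- Merging adjacent equal words does not change the meaning. -/
theorem mergeAdj_eval (f : Word → M) : ∀ (p : QPoly), evalP f (mergeAdj p) = evalP f p
  | [] => by simp [mergeAdj]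
  | t :: rest => by
    have ih := mergeAdj_eval f rest
    rw [mergeAdj]
    split
    · next h => rw [h] at ih; simp [← ih]
    · next t' rest' h =>
      rw [h] at ih
      split
      · next hw =>
        have hw' : t.2 = t'.2 := (wordEq_iff _ _).1 hw
        rw [evalP_cons, evalP_cons, ← ih, evalP_cons, hw', ← add_assoc, ← add_smul]
        push_cast; rfl
      · simp only [evalP_cons]
        rw [← ih, evalP_cons]

/-- **Soundness of the collector**: `collect` preserves meaning under every word semantics. -/
theorem collect_eval (f : Word → M) (p : QPoly) : evalP f (collect p) = evalP f p := by
  rw [collect, mergeAdj_eval, evalP_perm f (sortW_perm p)]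

omit [Module ℂ M] in
/-- Helper `evalP_eq_zero_of_all` (S2/collector chain). -/
theorem evalP_eq_zero_of_all {N : Type*} [AddCommGroup N] [Module ℂ N] (f : Word → N) :
    ∀ (p : QPoly), (p.all fun t => decide (t.1 = 0)) = true → evalP f p = 0
  | [], _ => by simp
  | t :: p, h => by
    simp only [List.all_cons, Bool.and_eq_true, decide_eq_true_eq] at h
    rw [evalP_cons, h.1, evalP_eq_zero_of_all f p h.2]; simp

/-- **Soundness of `isZero`**: all collected coefficients `0` ⇒ meaning `0` under every word semantics. -/
theorem isZero_sound (f : Word → M) (p : QPoly) (h : isZero p = true) : evalP f p = 0 := by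
  rw [← collect_eval f p]
  exact evalP_eq_zero_of_all f _ h

/-- The form S4 uses: `isZero p ⇒ polyOp Λ' p = 0`. -/
theorem polyOp_eq_zero_of_isZero (Λ' : Finset (Site 2)) (p : QPoly) (h : isZero p = true) : polyOp Λ' p = 0 :=
  isZero_sound (wordOp Λ') p h

end CollectSound

/-! #### MOVE EQUIVARIANCE of normal ordering, PROVED (rev 4; crit-2 l.743 (ii) / l.757: the semantic statement the
orbit-pair table consumes — no linear-independence lemma needed).  Explicit forms of S2 first. -/

/-- Isotony, explicit: a word supported in `Λ ⊆ Λ'` read in `Λ'` is the embedded word read in `Λ`. -/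
theorem wordOp_incl {Λ Λ' : Finset (Site 2)} (hΛ : Λ ⊆ Λ') (u : Word) (hu : SuppIn u Λ) :
    wordOp Λ' u = fermionEmbed (PolySite.incl hΛ) (wordOp Λ u) := by
  induction u with
  | nil => simp
  | cons ℓ u ih =>
    have hℓ : ℓ.x ∈ Λ := hu ℓ List.mem_cons_self
    rw [wordOp_cons, wordOp_cons, map_mul, ← ih (fun m hm => hu m (List.mem_cons_of_mem _ hm))]
    congr 1
    simp only [letterOp, dif_pos hℓ, dif_pos (hΛ hℓ)]
    rw [fermionEmbed_ladderLetter]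
    rfl

/-- Moves, explicit: `wordOp Λ' (γ·u + v) = Γ_{hsh} (Γ_{γ,v} (wordOp Λ u))`. -/
theorem wordOp_moveWord {Λ Λ' : Finset (Site 2)} {γ : DihedralGroup 4} {v : Site 2}
    (hsh : d4ShiftSet γ v Λ ⊆ Λ') (u : Word) (hu : SuppIn u Λ) :
    wordOp Λ' (moveWord γ v u) =
      fermionEmbed (PolySite.incl hsh) (fermionEmbed (PolySite.d4Emb γ v Λ) (wordOp Λ u)) := by
  induction u with
  | nil => simp [moveWord]
  | cons ℓ u ih =>
    have hℓ : ℓ.x ∈ Λ := hu ℓ List.mem_cons_self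
    have hm : moveSite γ v ℓ.x ∈ Λ' := moveSite_mem hsh hℓ
    have ih' := ih (fun m hm => hu m (List.mem_cons_of_mem _ hm))
    show wordOp Λ' (⟨moveSite γ v ℓ.x, ℓ.s, ℓ.dag⟩ :: moveWord γ v u) = _
    rw [wordOp_cons, wordOp_cons, map_mul, map_mul, ← ih']
    congr 1
    simp only [letterOp, dif_pos hm, dif_pos hℓ]
    rw [fermionEmbed_ladderLetter, fermionEmbed_ladderLetter, pt_moveSite hsh hℓ]
    rfl

/-- The letters of a moved word. -/
theorem suppIn_moveWord {Λ Λ' : Finset (Site 2)} {γ : DihedralGroup 4} {v : Site 2}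
    (hsh : d4ShiftSet γ v Λ ⊆ Λ') (u : Word) (hu : SuppIn u Λ) : SuppIn (moveWord γ v u) Λ' := by
  intro ℓ hℓ
  rw [moveWord, List.mem_map] at hℓ
  obtain ⟨m, hm, rfl⟩ := hℓ
  exact moveSite_mem hsh (hu m hm)

/-- Moving a polynomial termwise moves its operator. -/
theorem polyOp_movePolyW {Λ Λ' : Finset (Site 2)} {γ : DihedralGroup 4} {v : Site 2}
    (hsh : d4ShiftSet γ v Λ ⊆ Λ') (p : QPoly) (hp : ∀ t ∈ p, SuppIn t.2 Λ) :
    polyOp Λ' (movePolyW γ v p) =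
      fermionEmbed (PolySite.incl hsh) (fermionEmbed (PolySite.d4Emb γ v Λ) (polyOp Λ p)) := by
  induction p with
  | nil => simp [movePolyW]
  | cons t p ih =>
    have ih' := ih (fun s hs => hp s (List.mem_cons_of_mem _ hs))
    show polyOp Λ' ((t.1, moveWord γ v t.2) :: movePolyW γ v p) = _
    rw [polyOp_cons, polyOp_cons, map_add, map_add, map_smul, map_smul, ih',
      wordOp_moveWord hsh t.2 (hp t List.mem_cons_self)]

/-- **MOVE EQUIVARIANCE (operator level, PROVED from S1 + S2's explicit form):** normal-ordering the moved word and
moving the normal-ordered word have the SAME operator in the frame algebra.  Hence the same VALUE under every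
linear functional — invariant or not; invariance of the averaged window state enters only when a moved pair is
replaced by its canonical representative (`value_moveWord` below). -/
theorem moveOp_equivariant {Λ Λ' : Finset (Site 2)} {γ : DihedralGroup 4} {v : Site 2}
    (hsh : d4ShiftSet γ v Λ ⊆ Λ') (w : Word) (hw : SuppIn w Λ) :
    polyOp Λ' (nfWord (moveWord γ v w)) = polyOp Λ' (movePolyW γ v (nfWord w)) := by
  rw [← stub_nfFaithful Λ' _ (suppIn_moveWord hsh w hw), wordOp_moveWord hsh w hw,
    polyOp_movePolyW hsh (nfWord w) (fun t ht ℓ hℓ => hw ℓ (nfWord_letters w t ht hℓ)),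
    ← stub_nfFaithful Λ w hw]

/-- **VALUE form for the orbit-pair table (crit-2 l.757 (1)–(4)):** under any linear functional `φ` on the frame
algebra that is invariant under the licensed move (`φ ∘ Γ_{hsh} ∘ Γ_{γ,v} = φ ∘ Γ_{hΛ}` on `𝔄_Λ` — the D₄/shift
average the window soundness theorem builds), a moved word has the value of the unmoved one, and its normal
form may be taken before or after the move. -/
theorem value_moveWord {Λ Λ' : Finset (Site 2)} (hΛ : Λ ⊆ Λ') {γ : DihedralGroup 4} {v : Site 2}
    (hsh : d4ShiftSet γ v Λ ⊆ Λ') (φ : FermionOp Λ' →ₗ[ℂ] ℂ)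
    (hφ : ∀ Y : FermionOp Λ,
      φ (fermionEmbed (PolySite.incl hsh) (fermionEmbed (PolySite.d4Emb γ v Λ) Y)) = φ (fermionEmbed (PolySite.incl hΛ) Y))
    (w : Word) (hw : SuppIn w Λ) :
    φ (wordOp Λ' (moveWord γ v w)) = φ (wordOp Λ' w) ∧
      φ (polyOp Λ' (nfWord (moveWord γ v w))) = φ (polyOp Λ' (movePolyW γ v (nfWord w))) := by
  refine ⟨?_, by rw [moveOp_equivariant hsh w hw]⟩
  rw [wordOp_moveWord hsh w hw, hφ, ← wordOp_incl hΛ w hw]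

/-- `memSite` decides list membership. -/
theorem memSite_iff (x : Site 2) (S : List (Site 2)) : memSite x S = true ↔ x ∈ S := by
  simp [memSite, List.any_eq_true, siteEq_iff]

/-- `nodupSites` decides `List.Nodup`. -/
theorem nodup_of_nodupSites : ∀ (S : List (Site 2)), nodupSites S = true → S.Nodup
  | [], _ => List.nodup_nil
  | x :: S, h => by
      have h' : (!(memSite x S) && nodupSites S) = true := h
      rw [Bool.and_eq_true, Bool.not_eq_true'] at h'
      refine List.nodup_cons.2 ⟨fun hx => ?_, nodup_of_nodupSites S h'.2⟩
      have hm := (memSite_iff x S).2 hx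
      rw [hm] at h'
      exact Bool.false_ne_true h'.1.symm

/-! #### SOUNDNESS OF THE CANONICALISER `canonA` (rev 7, PROVED): under every linear functional invariant under
the per-word licensed affine-`D₄` moves, `canonA u` has the value of `u`.  This is the `useCanon` clause S4
consumes (with `φ :=` the averaged window state composed with `Γ`, invariant by `WardD4WindowSound` + S2),
and the formal answer to sym-ref-2's l.982 audit: whatever representative the fold picks, and in the
sign-odd branch, the replacement is justified — no orbit-completeness or uniqueness is used for soundness. -/

/-- Helper `suppIn_iff` (S2/collector chain). -/
theorem suppIn_iff (w : Word) (S : List (Site 2)) : suppIn w S = true ↔ SuppIn w S.toFinset := by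
  simp only [suppIn, List.all_eq_true, memSite_iff, SuppIn, List.mem_toFinset]

/-- Helper `polyOp_of_polyNegEq` (S2/collector chain). -/
theorem polyOp_of_polyNegEq (Λ' : Finset (Site 2)) :
    ∀ (p q : QPoly), polyNegEq p q = true → polyOp Λ' q = -polyOp Λ' p
  | [], [], _ => by simp
  | [], _ :: _, h => by simp [polyNegEq] at h
  | _ :: _, [], h => by simp [polyNegEq] at h
  | t :: p, t' :: q, h => by
    simp only [polyNegEq, Bool.and_eq_true, decide_eq_true_eq, wordEq_iff] at h
    obtain ⟨⟨hw, hc⟩, hr⟩ := h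
    rw [polyOp_cons, polyOp_cons, polyOp_of_polyNegEq Λ' p q hr, ← hw, hc, neg_add, Rat.cast_neg, neg_smul]

/-- Helper `foldl_pick_mem` (S2/collector chain). -/
theorem foldl_pick_mem (f : QPoly → QPoly → Bool) :
    ∀ (l : List QPoly) (c : QPoly), l.foldl (fun b c' => if f c' b then c' else b) c ∈ c :: l
  | [], c => by simp
  | c' :: l, c => by
    rw [List.foldl_cons]
    have h := foldl_pick_mem f l (if f c' c then c' else c)
    rw [List.mem_cons] at h
    rcases h with h | h
    · rw [h]
      split
      · exact List.mem_cons_of_mem _ List.mem_cons_self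
      · exact List.mem_cons_self
    · exact List.mem_cons_of_mem _ (List.mem_cons_of_mem _ h)

end Summit.Ventures.CertifiedManyBodySolver.Theorems.SymReplay

end
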